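import Summits.BirchSwinnertonDyer.BirchSwinnertonDyer.Theorems.SignedLowerHalvesSprungLowerDivisibilityAtThreeCokerBoundByMassKeying
import Summits.BirchSwinnertonDyer.BirchSwinnertonDyer.Theorems.SignedLowerHalvesSprungLowerDivisibilityAtThreeCokerBoundByMassMatar
import HarnessLib

/-!
# Crux `SprungLowerDivisibilityAtThree` (item stmt-BirchSwinnertonDyer-19875; x8 children 22569 / 22901 / 22570 / 23112),
# line `chromatic-common-zeros`: «F-α♮ BY MASS», part 4 — the PRINT-KEYED (`_contra`, C′) family: F-α♮ for the packages
# `SharpFlatColemanKatoDataContra` and the `γ⁻¹`-keyed fine datum, from (M1) in EITHER keying + Matar 2020 + Kato's fine torsion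

Cell `bsd-ssimc` (host), width seat `cruxlead-stmt-BirchSwinnertonDyer-19875-w2` (gen 9) under the 19875 LEAD; `--supports`
stmt-BirchSwinnertonDyer-22569 `--as helper`; theorems only; closes NO item. For the LEAD's Contra port of the ι-door (pen S35-9 (3);
director (267) (B) `PrintX8VSC`): the F-α♮ hypothesis of a Contra `stubs_offT_of_iotaDoor` can be taken to be the CONCLUSION of
`cokerBoundIotaOffT_contra_of_cotorsion_of_matar` below (same telescope as the registered γ-keyed stub with `SharpFlatColemanKatoDataContra`
packages and `Y' : W.FineSelmerDualData κ γ⁻¹`, bound `ℓ_{ι𝔭} Y'.X`). HONEST FRAMING: CONDITIONAL on (M1) (displayed; its one typed input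
is the Poitou–Tate structure of `…CokerBoundByMassKeying` §3) and on the named facts `matar2020_thm11_selmerDualTorsion_pseudoIso_fineSelmerDual`,
`Kato2004_fineSelmerDual_isTorsion`; K_spor, S4b-cyc, K1, leaf X8, the C′ twin and BSD are NOT proved by anything here.

* §1 `massCotorsion_contraFamily_of_family` — (M1) for the `γ`-keyed family ⟹ (M1) for the `γ⁻¹`-keyed family (converse of
  `massCotorsion_of_contraFamily`; so (M1) in either keying serves either stub).
* §2 `cotorsion_contra_le_fine_comap_invol_of_matar` — (M2) for the `γ⁻¹`-keyed family: `ℓ_𝔭 tors S'.X ≤ ℓ_{ι𝔭} Y'.X`, by name from Matar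
  (`ℓ_𝔭 tors S' = ℓ_{ι𝔭} tors S = ℓ_𝔭 Y = ℓ_{ι𝔭} Y'`).
* §3 `massIota_contra_of_cotorsion_of_fine` — (MASS♮)-contra ⟸ (M1)-contra ∧ (M2)-contra; `cokerBoundIotaOffT_contra_of_massIota` — the
  Contra F-α♮ telescope from (MASS♮)-contra + `Kato2004_fineSelmerDual_isTorsion` (`min_lengthAt_cokernel_le_of_mass_contra`, p665043).
* §4 `cokerBoundIotaOffT_contra_of_cotorsion_of_matar (hM1) (hMatar) (hfine)` — the Contra F-α♮ telescope from the γ-KEYED (M1) + the two facts.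

References: [Sprung2012] Thm. 7.14 (3) (p. 1504), Prop. 7.19; [Kato2004Asterisque] Thm. 12.4, (17.13.1); [Matar2020] Thm. 1.1; [Wingberg1989]
Cor. 2.5; [Greenberg1989] §0; tree: `…CokerBoundByMass{,Skeleton,Matar,Keying}` (p665043, p665510, p665840, p666310),
`Sprung2012/SharpFlatColemanKatoContragredient` (p662311), `Kato2004/IwasawaInvolutionTwistProofs`.
-/

set_option linter.dupNamespace false
set_option autoImplicit false

noncomputable section

open scoped Classical NumberField MatrixGroups ModularForm

open NumberField IsDedekindDomain CongruenceSubgroup WeierstrassCurve Field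
  Literature.NumberTheory.EllipticCurves Literature.NumberTheory.EllipticCurves.ModularForms
  Literature.NumberTheory.EllipticCurves.ZpExtension Literature.NumberTheory.EllipticCurves.Sprung2017
  Literature.NumberTheory.EllipticCurves.Sprung2012 Literature.NumberTheory.EllipticCurves.Rank1Residual
  Literature.NumberTheory.EllipticCurves.IwasawaAlgebra Literature.NumberTheory.EllipticCurves.Kato2004
  Literature.NumberTheory.EllipticCurves.Module

namespace Summit.BirchSwinnertonDyer.BirchSwinnertonDyer.Theorems.ChromaticCommonZeros

/-- `p ∉ ι𝔭`, `T ∉ ι𝔭` and `ι𝔭` of height one, when `𝔭` is (`ι` fixes constants; `ι(T)·(1+T) = −T`). [folklore] -/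
private theorem mirror_prime_sideConditions {p : ℕ} [Fact p.Prime] (𝔭 : PrimeSpectrum (IwasawaAlgebra p))
    (h𝔭 : 𝔭.asIdeal.height = 1) (hp𝔭 : (p : IwasawaAlgebra p) ∉ 𝔭.asIdeal)
    (hT𝔭 : (PowerSeries.X : IwasawaAlgebra p) ∉ 𝔭.asIdeal) :
    (PrimeSpectrum.comap (invol p).toRingHom 𝔭).asIdeal.height = 1 ∧
      (p : IwasawaAlgebra p) ∉ (PrimeSpectrum.comap (invol p).toRingHom 𝔭).asIdeal ∧
      (PowerSeries.X : IwasawaAlgebra p) ∉ (PrimeSpectrum.comap (invol p).toRingHom 𝔭).asIdeal := by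
  refine ⟨(Kato2004.height_comap_invol 𝔭).trans h𝔭, ?_, ?_⟩
  · rw [PrimeSpectrum.comap_asIdeal, Ideal.mem_comap, ← map_natCast (PowerSeries.C (R := ℤ_[p])) p]
    change invol p (PowerSeries.C (p : ℤ_[p])) ∉ 𝔭.asIdeal
    rw [invol_C, map_natCast]
    exact hp𝔭
  · rw [PrimeSpectrum.comap_asIdeal, Ideal.mem_comap]
    change invol p PowerSeries.X ∉ 𝔭.asIdeal
    have hu : IsUnit (1 + PowerSeries.X : IwasawaAlgebra p) := by
      rw [PowerSeries.isUnit_iff_constantCoeff, map_add, map_one, PowerSeries.constantCoeff_X, add_zero]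
      exact isUnit_one
    rw [← Ideal.mul_unit_mem_iff_mem 𝔭.asIdeal hu, invol_X_mul_one_add_X, neg_mem_iff]
    exact hT𝔭

/-! ### §1 (M1): the `γ`-keyed family implies the `γ⁻¹`-keyed family -/

section KeyingConverse

/-- **(M1) IS KEYING-IMMUNE (converse direction of `massCotorsion_of_contraFamily`):** (M1) for the `γ`-keyed pinned duals at every
height-one `𝔭 ∌ p, T` ⟹ (M1) for the `γ⁻¹`-keyed (print-keyed) duals (read at `ι𝔭`, move lengths across `ι`).
[cite: Greenberg1989, §0 pp. 101–102] [cite: GreenbergLNM1716, §1 p. 60] -/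
theorem massCotorsion_contraFamily_of_family
    (hM1 : ∀ (W : WeierstrassCurve ℚ) [W.IsElliptic] [W.IsGloballyMinimal] (p : ℕ) [Fact p.Prime],
      ClassX8 W p → ∀ (κ : ZpExtension ℚ p) (γ : Field.absoluteGaloisGroup ℚ),
      κ.IsCyclotomic → κ.IsTopGenerator γ →
    ∀ (v : HeightOneSpectrum (𝓞 ℚ)), (p : 𝓞 ℚ) ∈ v.asIdeal →
    ∀ (g : Field.absoluteGaloisGroup (v.adicCompletion ℚ)),
      κ.IsTopGenerator (resGalOfEmb (closureEmb (K := ℚ) (v.adicCompletion ℚ)) g) →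
    ∀ (cneg : localPoints W (v.adicCompletion ℚ)) (c : ℕ → localPoints W (v.adicCompletion ℚ)),
      IsHondaSystem κ (closureEmb (K := ℚ) (v.adicCompletion ℚ)) W (W.frobeniusTrace p) g cneg c →
    ∀ (S : W.SelmerDualData κ γ)
      (Ds : SharpFlatSelmerDualData W κ γ (closureEmb (K := ℚ) (v.adicCompletion ℚ)) (W.frobeniusTrace p) g c
        Chroma.sharp)
      (Df : SharpFlatSelmerDualData W κ γ (closureEmb (K := ℚ) (v.adicCompletion ℚ)) (W.frobeniusTrace p) g c
        Chroma.flat)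
      (Y : W.FineSelmerDualData κ γ) (𝔭 : PrimeSpectrum (IwasawaAlgebra p)), 𝔭.asIdeal.height = 1 →
      (p : IwasawaAlgebra p) ∉ 𝔭.asIdeal → (PowerSeries.X : IwasawaAlgebra p) ∉ 𝔭.asIdeal →
      min (Module.lengthAt (IwasawaAlgebra p) Ds.X 𝔭) (Module.lengthAt (IwasawaAlgebra p) Df.X 𝔭) ≤
        Module.lengthAt (IwasawaAlgebra p) Y.X 𝔭 +
          Module.lengthAt (IwasawaAlgebra p) (Submodule.torsion (IwasawaAlgebra p) S.X) 𝔭) :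
    ∀ (W : WeierstrassCurve ℚ) [W.IsElliptic] [W.IsGloballyMinimal] (p : ℕ) [Fact p.Prime],
      ClassX8 W p → ∀ (κ : ZpExtension ℚ p) (γ : Field.absoluteGaloisGroup ℚ),
      κ.IsCyclotomic → κ.IsTopGenerator γ →
    ∀ (v : HeightOneSpectrum (𝓞 ℚ)), (p : 𝓞 ℚ) ∈ v.asIdeal →
    ∀ (g : Field.absoluteGaloisGroup (v.adicCompletion ℚ)),
      κ.IsTopGenerator (resGalOfEmb (closureEmb (K := ℚ) (v.adicCompletion ℚ)) g) →
    ∀ (cneg : localPoints W (v.adicCompletion ℚ)) (c : ℕ → localPoints W (v.adicCompletion ℚ)),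
      IsHondaSystem κ (closureEmb (K := ℚ) (v.adicCompletion ℚ)) W (W.frobeniusTrace p) g cneg c →
    ∀ (S' : W.SelmerDualData κ γ⁻¹)
      (Ds' : SharpFlatSelmerDualData W κ γ⁻¹ (closureEmb (K := ℚ) (v.adicCompletion ℚ)) (W.frobeniusTrace p) g c
        Chroma.sharp)
      (Df' : SharpFlatSelmerDualData W κ γ⁻¹ (closureEmb (K := ℚ) (v.adicCompletion ℚ)) (W.frobeniusTrace p) g c
        Chroma.flat)
      (Y' : W.FineSelmerDualData κ γ⁻¹) (𝔭 : PrimeSpectrum (IwasawaAlgebra p)), 𝔭.asIdeal.height = 1 →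
      (p : IwasawaAlgebra p) ∉ 𝔭.asIdeal → (PowerSeries.X : IwasawaAlgebra p) ∉ 𝔭.asIdeal →
      min (Module.lengthAt (IwasawaAlgebra p) Ds'.X 𝔭) (Module.lengthAt (IwasawaAlgebra p) Df'.X 𝔭) ≤
        Module.lengthAt (IwasawaAlgebra p) Y'.X 𝔭 +
          Module.lengthAt (IwasawaAlgebra p) (Submodule.torsion (IwasawaAlgebra p) S'.X) 𝔭 := by
  intro W _ _ p _ hX κ γ hκ hγ v hv g hg cneg c hH S' Ds' Df' Y' 𝔭 h𝔭 hp𝔭 hT𝔭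
  obtain ⟨S, -, -, -⟩ := selmerDualData_exists_involTwist (inv_mul_cancel γ) S'
  obtain ⟨Ds⟩ := nonempty_sharpFlatSelmerDualData' W κ (closureEmb (K := ℚ) (v.adicCompletion ℚ))
    (W.frobeniusTrace p) g c Chroma.sharp γ
  obtain ⟨Df⟩ := nonempty_sharpFlatSelmerDualData' W κ (closureEmb (K := ℚ) (v.adicCompletion ℚ))
    (W.frobeniusTrace p) g c Chroma.flat γ
  obtain ⟨Y, -, -, -⟩ := Kato2004.fineSelmerDualData_exists_involTwist (inv_mul_cancel γ) Y'
  set 𝔮 : PrimeSpectrum (IwasawaAlgebra p) := PrimeSpectrum.comap (invol p).toRingHom 𝔭 with h𝔮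
  obtain ⟨h𝔮1, hp𝔮, hT𝔮⟩ := mirror_prime_sideConditions 𝔭 h𝔭 hp𝔭 hT𝔭
  have h := hM1 W p hX κ γ hκ hγ v hv g hg cneg c hH S Ds Df Y 𝔮 h𝔮1 hp𝔮 hT𝔮
  rwa [h𝔮, sharpFlatSelmerDualData_lengthAt_eq_inv Ds Ds', sharpFlatSelmerDualData_lengthAt_eq_inv Df Df',
    Kato2004.fineSelmerDualData_lengthAt_eq_inv Y Y', ← selmerDualData_lengthAt_torsion_inv_eq S S' _,
    Kato2004.comap_invol_comap_invol] at h

end KeyingConverse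

/-! ### §2 (M2) for the `γ⁻¹`-keyed family, by name from Matar 2020 -/

section MatarContra

/-- **(M2) for the print-keyed duals:** on class X8, for `S' : W.SelmerDualData κ γ⁻¹` and `Y' : W.FineSelmerDualData κ γ⁻¹`, at every
height-one `𝔭`: `ℓ_𝔭(tors_Λ S'.X) ≤ ℓ_{ι𝔭}(Y'.X)` — `ℓ_𝔭 tors S' = ℓ_{ι𝔭} tors S = ℓ_𝔭 Y = ℓ_{ι𝔭} Y'` for the `γ`-keyed twists `S, Y`
(`selmerDualData_lengthAt_torsion_inv_eq`, Matar at `ι𝔭`, `fineSelmerDualData_lengthAt_eq_inv`). CONDITIONAL on the two named facts.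
[cite: Matar2020, Thm. 1.1] [cite: Wingberg1989, Cor. 2.5] [cite: Kato2004Asterisque, Thm. 12.4 (1) (p. 221)] [cite: Greenberg1989, §0] -/
theorem cotorsion_contra_le_fine_comap_invol_of_matar
    (hMatar : matar2020_thm11_selmerDualTorsion_pseudoIso_fineSelmerDual) (hfine : Kato2004_fineSelmerDual_isTorsion) :
    ∀ (W : WeierstrassCurve ℚ) [W.IsElliptic] [W.IsGloballyMinimal] (p : ℕ) [Fact p.Prime],
      ClassX8 W p → ∀ (κ : ZpExtension ℚ p) (γ : Field.absoluteGaloisGroup ℚ),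
      κ.IsCyclotomic → κ.IsTopGenerator γ →
    ∀ (S' : W.SelmerDualData κ γ⁻¹) (Y' : W.FineSelmerDualData κ γ⁻¹) (𝔭 : PrimeSpectrum (IwasawaAlgebra p)),
      𝔭.asIdeal.height = 1 → (p : IwasawaAlgebra p) ∉ 𝔭.asIdeal →
      Module.lengthAt (IwasawaAlgebra p) (Submodule.torsion (IwasawaAlgebra p) S'.X) 𝔭 ≤
        Module.lengthAt (IwasawaAlgebra p) Y'.X (PrimeSpectrum.comap (invol p).toRingHom 𝔭) := by
  intro W _ _ p _ hX κ γ hκ hγ S' Y' 𝔭 h𝔭 _hp𝔭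
  obtain ⟨hp3, ⟨hgood, hss⟩, -⟩ := hX
  subst hp3
  obtain ⟨S, -, -, -⟩ := selmerDualData_exists_involTwist (inv_mul_cancel γ) S'
  obtain ⟨Y, -, -, -⟩ := Kato2004.fineSelmerDualData_exists_involTwist (inv_mul_cancel γ) Y'
  have h1 := lengthAt_torsion_selmerDual_eq_fine_comap_invol_of_matar hMatar hfine W 3 (by decide) hgood hss hκ hγ S Y
    (PrimeSpectrum.comap (invol 3).toRingHom 𝔭) (((Kato2004.height_comap_invol 𝔭).trans h𝔭).le)
  rw [Kato2004.comap_invol_comap_invol, ← selmerDualData_lengthAt_torsion_inv_eq S S' 𝔭] at h1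
  exact (h1.trans (Kato2004.fineSelmerDualData_lengthAt_eq_inv Y Y' 𝔭)).le

end MatarContra

/-! ### §3 The Contra F-α♮ telescope from (MASS♮)-contra + fine torsion -/

section ContraStub

/-- **(MASS♮) for the print-keyed family from its two halves** ((M1)-contra, (M2)-contra; the Selmer dual `S'` of key `γ⁻¹` exists as the
`ι`-twist of `WeierstrassCurve.selmerDualData`). [cite: Kato2004Asterisque, (17.13.1) (p. 279)] [cite: Matar2020, Thm. 1.1] -/
theorem massIota_contra_of_cotorsion_of_fine
    (hM1' : ∀ (W : WeierstrassCurve ℚ) [W.IsElliptic] [W.IsGloballyMinimal] (p : ℕ) [Fact p.Prime],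
      ClassX8 W p → ∀ (κ : ZpExtension ℚ p) (γ : Field.absoluteGaloisGroup ℚ),
      κ.IsCyclotomic → κ.IsTopGenerator γ →
    ∀ (v : HeightOneSpectrum (𝓞 ℚ)), (p : 𝓞 ℚ) ∈ v.asIdeal →
    ∀ (g : Field.absoluteGaloisGroup (v.adicCompletion ℚ)),
      κ.IsTopGenerator (resGalOfEmb (closureEmb (K := ℚ) (v.adicCompletion ℚ)) g) →
    ∀ (cneg : localPoints W (v.adicCompletion ℚ)) (c : ℕ → localPoints W (v.adicCompletion ℚ)),
      IsHondaSystem κ (closureEmb (K := ℚ) (v.adicCompletion ℚ)) W (W.frobeniusTrace p) g cneg c →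
    ∀ (S' : W.SelmerDualData κ γ⁻¹)
      (Ds' : SharpFlatSelmerDualData W κ γ⁻¹ (closureEmb (K := ℚ) (v.adicCompletion ℚ)) (W.frobeniusTrace p) g c
        Chroma.sharp)
      (Df' : SharpFlatSelmerDualData W κ γ⁻¹ (closureEmb (K := ℚ) (v.adicCompletion ℚ)) (W.frobeniusTrace p) g c
        Chroma.flat)
      (Y' : W.FineSelmerDualData κ γ⁻¹) (𝔭 : PrimeSpectrum (IwasawaAlgebra p)), 𝔭.asIdeal.height = 1 →
      (p : IwasawaAlgebra p) ∉ 𝔭.asIdeal → (PowerSeries.X : IwasawaAlgebra p) ∉ 𝔭.asIdeal →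
      min (Module.lengthAt (IwasawaAlgebra p) Ds'.X 𝔭) (Module.lengthAt (IwasawaAlgebra p) Df'.X 𝔭) ≤
        Module.lengthAt (IwasawaAlgebra p) Y'.X 𝔭 +
          Module.lengthAt (IwasawaAlgebra p) (Submodule.torsion (IwasawaAlgebra p) S'.X) 𝔭)
    (hM2' : ∀ (W : WeierstrassCurve ℚ) [W.IsElliptic] [W.IsGloballyMinimal] (p : ℕ) [Fact p.Prime],
      ClassX8 W p → ∀ (κ : ZpExtension ℚ p) (γ : Field.absoluteGaloisGroup ℚ),
      κ.IsCyclotomic → κ.IsTopGenerator γ →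
    ∀ (S' : W.SelmerDualData κ γ⁻¹) (Y' : W.FineSelmerDualData κ γ⁻¹) (𝔭 : PrimeSpectrum (IwasawaAlgebra p)),
      𝔭.asIdeal.height = 1 → (p : IwasawaAlgebra p) ∉ 𝔭.asIdeal →
      Module.lengthAt (IwasawaAlgebra p) (Submodule.torsion (IwasawaAlgebra p) S'.X) 𝔭 ≤
        Module.lengthAt (IwasawaAlgebra p) Y'.X (PrimeSpectrum.comap (invol p).toRingHom 𝔭)) :
    ∀ (W : WeierstrassCurve ℚ) [W.IsElliptic] [W.IsGloballyMinimal] (p : ℕ) [Fact p.Prime],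
      ClassX8 W p → ∀ (κ : ZpExtension ℚ p) (γ : Field.absoluteGaloisGroup ℚ),
      κ.IsCyclotomic → κ.IsTopGenerator γ →
    ∀ (v : HeightOneSpectrum (𝓞 ℚ)), (p : 𝓞 ℚ) ∈ v.asIdeal →
    ∀ (g : Field.absoluteGaloisGroup (v.adicCompletion ℚ)),
      κ.IsTopGenerator (resGalOfEmb (closureEmb (K := ℚ) (v.adicCompletion ℚ)) g) →
    ∀ (cneg : localPoints W (v.adicCompletion ℚ)) (c : ℕ → localPoints W (v.adicCompletion ℚ)),
      IsHondaSystem κ (closureEmb (K := ℚ) (v.adicCompletion ℚ)) W (W.frobeniusTrace p) g cneg c →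
    ∀ (Ds' : SharpFlatSelmerDualData W κ γ⁻¹ (closureEmb (K := ℚ) (v.adicCompletion ℚ)) (W.frobeniusTrace p) g c
        Chroma.sharp)
      (Df' : SharpFlatSelmerDualData W κ γ⁻¹ (closureEmb (K := ℚ) (v.adicCompletion ℚ)) (W.frobeniusTrace p) g c
        Chroma.flat)
      (Y' : W.FineSelmerDualData κ γ⁻¹) (𝔭 : PrimeSpectrum (IwasawaAlgebra p)), 𝔭.asIdeal.height = 1 →
      (p : IwasawaAlgebra p) ∉ 𝔭.asIdeal → (PowerSeries.X : IwasawaAlgebra p) ∉ 𝔭.asIdeal →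
      min (Module.lengthAt (IwasawaAlgebra p) Ds'.X 𝔭) (Module.lengthAt (IwasawaAlgebra p) Df'.X 𝔭) ≤
        Module.lengthAt (IwasawaAlgebra p) Y'.X 𝔭 +
          Module.lengthAt (IwasawaAlgebra p) Y'.X (PrimeSpectrum.comap (invol p).toRingHom 𝔭) := by
  intro W _ _ p _ hX κ γ hκ hγ v hv g hg cneg c hH Ds' Df' Y' 𝔭 h𝔭 hp𝔭 hT𝔭
  obtain ⟨S', -, -, -⟩ := selmerDualData_exists_involTwist (mul_inv_cancel γ) (W.selmerDualData κ hγ)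
  exact (hM1' W p hX κ γ hκ hγ v hv g hg cneg c hH S' Ds' Df' Y' 𝔭 h𝔭 hp𝔭 hT𝔭).trans
    (add_le_add le_rfl (hM2' W p hX κ γ hκ hγ S' Y' 𝔭 h𝔭 hp𝔭))

/-- **THE CONTRA F-α♮ TELESCOPE from (MASS♮)-contra and the torsion of `X₀`** — the print-keyed twin of `cokerBoundIotaOffT_of_massIota`:
same binders as the registered stub `IotaDoor.stub_cokerBoundIotaOffT` with the packages `Cs, Cf : SharpFlatColemanKatoDataContra … I` (p662311)
and the fine datum `Y' : W.FineSelmerDualData κ γ⁻¹`; conclusion `min(ℓ_𝔭 Λ/range Cs.colMap, ℓ_𝔭 Λ/range Cf.colMap) ≤ ℓ_{ι𝔭} Y'.X`. A natural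
text for the Contra ι-door's F-α♮ hypothesis. Proof: `min_lengthAt_cokernel_le_of_mass_contra` (p665043) with `ℓ_𝔭 Y' = ℓ_{ι𝔭} Y ≠ ⊤`.
[cite: Sprung2012, Thm. 7.14 with exact sequence (3) (p. 1504), Prop. 7.19 (p. 1505)] [cite: Kato2004Asterisque, Thm. 12.4 (p. 221), (17.13.1) (p. 279)]
[cite: Wingberg1989, Cor. 2.5] [cite: Matar2020, Thm. 1.1] -/
theorem cokerBoundIotaOffT_contra_of_massIota
    (hMass' : ∀ (W : WeierstrassCurve ℚ) [W.IsElliptic] [W.IsGloballyMinimal] (p : ℕ) [Fact p.Prime],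
      ClassX8 W p → ∀ (κ : ZpExtension ℚ p) (γ : Field.absoluteGaloisGroup ℚ),
      κ.IsCyclotomic → κ.IsTopGenerator γ →
    ∀ (v : HeightOneSpectrum (𝓞 ℚ)), (p : 𝓞 ℚ) ∈ v.asIdeal →
    ∀ (g : Field.absoluteGaloisGroup (v.adicCompletion ℚ)),
      κ.IsTopGenerator (resGalOfEmb (closureEmb (K := ℚ) (v.adicCompletion ℚ)) g) →
    ∀ (cneg : localPoints W (v.adicCompletion ℚ)) (c : ℕ → localPoints W (v.adicCompletion ℚ)),
      IsHondaSystem κ (closureEmb (K := ℚ) (v.adicCompletion ℚ)) W (W.frobeniusTrace p) g cneg c →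
    ∀ (Ds' : SharpFlatSelmerDualData W κ γ⁻¹ (closureEmb (K := ℚ) (v.adicCompletion ℚ)) (W.frobeniusTrace p) g c
        Chroma.sharp)
      (Df' : SharpFlatSelmerDualData W κ γ⁻¹ (closureEmb (K := ℚ) (v.adicCompletion ℚ)) (W.frobeniusTrace p) g c
        Chroma.flat)
      (Y' : W.FineSelmerDualData κ γ⁻¹) (𝔭 : PrimeSpectrum (IwasawaAlgebra p)), 𝔭.asIdeal.height = 1 →
      (p : IwasawaAlgebra p) ∉ 𝔭.asIdeal → (PowerSeries.X : IwasawaAlgebra p) ∉ 𝔭.asIdeal →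
      min (Module.lengthAt (IwasawaAlgebra p) Ds'.X 𝔭) (Module.lengthAt (IwasawaAlgebra p) Df'.X 𝔭) ≤
        Module.lengthAt (IwasawaAlgebra p) Y'.X 𝔭 +
          Module.lengthAt (IwasawaAlgebra p) Y'.X (PrimeSpectrum.comap (invol p).toRingHom 𝔭))
    (hfine : Kato2004_fineSelmerDual_isTorsion) :
    ∀ (W : WeierstrassCurve ℚ) [W.IsElliptic] [W.IsGloballyMinimal] (p : ℕ) [Fact p.Prime]
      [ContinuousSMul ℤ_[p] (W.tateModule p)] [Module.Free ℤ_[p] (W.tateModule p)]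
      [Module.Finite ℤ_[p] (W.tateModule p)],
      ClassX8 W p → ∀ (κ : ZpExtension ℚ p) (γ : Field.absoluteGaloisGroup ℚ),
      κ.IsCyclotomic → κ.IsTopGenerator γ → IsCyclotomicVariable p γ →
    ∀ (v : HeightOneSpectrum (𝓞 ℚ)), (p : 𝓞 ℚ) ∈ v.asIdeal →
    ∀ (g : Field.absoluteGaloisGroup (v.adicCompletion ℚ)),
      κ.IsTopGenerator (resGalOfEmb (closureEmb (K := ℚ) (v.adicCompletion ℚ)) g) →
    ∀ (cneg : localPoints W (v.adicCompletion ℚ)) (c : ℕ → localPoints W (v.adicCompletion ℚ)),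
      IsHondaSystem κ (closureEmb (K := ℚ) (v.adicCompletion ℚ)) W (W.frobeniusTrace p) g cneg c →
    ∀ (N : ℕ) (_ : NeZero N) (f : CuspForm (Gamma0 N) 2) (ϖ : ℚ) (Lsharp Lflat : IwasawaAlgebra p),
      IsNewformOf W f → (ϖ : ℝ) * W.realPeriodRat = plusPeriod f →
      IsSprungPair f p (W.frobeniusTrace p) Lsharp Lflat →
    ∀ (I : Kato2004.IwasawaH1Data W p κ γ)
      (Cs : SharpFlatColemanKatoDataContra W p f ϖ κ γ (closureEmb (K := ℚ) (v.adicCompletion ℚ))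
        (W.frobeniusTrace p) g c Chroma.sharp I)
      (Cf : SharpFlatColemanKatoDataContra W p f ϖ κ γ (closureEmb (K := ℚ) (v.adicCompletion ℚ))
        (W.frobeniusTrace p) g c Chroma.flat I),
      Cs.Z = Cf.Z →
    ∀ (Y' : W.FineSelmerDualData κ γ⁻¹) (𝔭 : PrimeSpectrum (IwasawaAlgebra p)), 𝔭.asIdeal.height = 1 →
      (p : IwasawaAlgebra p) ∉ 𝔭.asIdeal → (PowerSeries.X : IwasawaAlgebra p) ∉ 𝔭.asIdeal →
      (∀ (col' : Chroma) (G' : IwasawaAlgebra p),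
        iwasawaToPowerSeries p G' =
          PowerSeries.C (ϖ : ℚ_[p]) * iwasawaToPowerSeries p (chromaticL col' Lsharp Lflat) →
        G' ∈ 𝔭.asIdeal) →
      min (Module.lengthAt (IwasawaAlgebra p) (IwasawaAlgebra p ⧸ LinearMap.range Cs.colMap) 𝔭)
          (Module.lengthAt (IwasawaAlgebra p) (IwasawaAlgebra p ⧸ LinearMap.range Cf.colMap) 𝔭) ≤
        Module.lengthAt (IwasawaAlgebra p) Y'.X (PrimeSpectrum.comap (invol p).toRingHom 𝔭) := by
  intro W _ _ p _ _ _ _ hX κ γ hκ hγ _hcv v hv g hg cneg c hH N _ f ϖ Lsharp Lflat _hnew _hϖ _hSP I Cs Cf _hZ Y' 𝔭 h𝔭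
    hp𝔭 hT𝔭 _hzero
  obtain ⟨Ds'⟩ := nonempty_sharpFlatSelmerDualData' W κ (closureEmb (K := ℚ) (v.adicCompletion ℚ))
    (W.frobeniusTrace p) g c Chroma.sharp γ⁻¹
  obtain ⟨Df'⟩ := nonempty_sharpFlatSelmerDualData' W κ (closureEmb (K := ℚ) (v.adicCompletion ℚ))
    (W.frobeniusTrace p) g c Chroma.flat γ⁻¹
  obtain ⟨Y, -, -, -⟩ := Kato2004.fineSelmerDualData_exists_involTwist (inv_mul_cancel γ) Y'
  have hfin : Module.lengthAt (IwasawaAlgebra p) Y'.X 𝔭 ≠ ⊤ := by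
    haveI := WeierstrassCurve.FineSelmerDualData.module_finite W κ hγ Y
    rw [Kato2004.fineSelmerDualData_lengthAt_inv_eq Y Y' 𝔭]
    exact IwasawaAlgebra.lengthAt_ne_top_of_isTorsion_of_height_le_one p Y.X (hfine W p κ γ hκ hγ Y) _
      ((Kato2004.height_comap_invol 𝔭).trans h𝔭).le
  exact min_lengthAt_cokernel_le_of_mass_contra Cs Cf Ds' Df' Y' 𝔭 hfin
    (hMass' W p hX κ γ hκ hγ v hv g hg cneg c hH Ds' Df' Y' 𝔭 h𝔭 hp𝔭 hT𝔭)

/-- **THE CONTRA F-α♮ TELESCOPE from the γ-KEYED (M1) and the named facts of Matar 2020 and Kato 2004** (composition: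
`cokerBoundIotaOffT_contra_of_massIota ∘ massIota_contra_of_cotorsion_of_fine ∘ (massCotorsion_contraFamily_of_family,
cotorsion_contra_le_fine_comap_invol_of_matar)`). So ONE discharge of (M1) — in either keying, cf. `massCotorsion_of_contraFamily` — closes
F-α♮ for the registered γ-keyed ι-door (`cokerBoundIotaOffT_of_cotorsion_of_matar`) AND for its C′ / Contra twin.
[cite: Kato2004Asterisque, Thm. 12.4 (p. 221), (17.13.1) (p. 279)] [cite: Matar2020, Thm. 1.1] [cite: Wingberg1989, Cor. 2.5]
[cite: Sprung2012, Thm. 7.14 (3) (p. 1504), Prop. 7.19 (p. 1505)] -/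
theorem cokerBoundIotaOffT_contra_of_cotorsion_of_matar
    (hM1 : ∀ (W : WeierstrassCurve ℚ) [W.IsElliptic] [W.IsGloballyMinimal] (p : ℕ) [Fact p.Prime],
      ClassX8 W p → ∀ (κ : ZpExtension ℚ p) (γ : Field.absoluteGaloisGroup ℚ),
      κ.IsCyclotomic → κ.IsTopGenerator γ →
    ∀ (v : HeightOneSpectrum (𝓞 ℚ)), (p : 𝓞 ℚ) ∈ v.asIdeal →
    ∀ (g : Field.absoluteGaloisGroup (v.adicCompletion ℚ)),
      κ.IsTopGenerator (resGalOfEmb (closureEmb (K := ℚ) (v.adicCompletion ℚ)) g) →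
    ∀ (cneg : localPoints W (v.adicCompletion ℚ)) (c : ℕ → localPoints W (v.adicCompletion ℚ)),
      IsHondaSystem κ (closureEmb (K := ℚ) (v.adicCompletion ℚ)) W (W.frobeniusTrace p) g cneg c →
    ∀ (S : W.SelmerDualData κ γ)
      (Ds : SharpFlatSelmerDualData W κ γ (closureEmb (K := ℚ) (v.adicCompletion ℚ)) (W.frobeniusTrace p) g c
        Chroma.sharp)
      (Df : SharpFlatSelmerDualData W κ γ (closureEmb (K := ℚ) (v.adicCompletion ℚ)) (W.frobeniusTrace p) g c
        Chroma.flat)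
      (Y : W.FineSelmerDualData κ γ) (𝔭 : PrimeSpectrum (IwasawaAlgebra p)), 𝔭.asIdeal.height = 1 →
      (p : IwasawaAlgebra p) ∉ 𝔭.asIdeal → (PowerSeries.X : IwasawaAlgebra p) ∉ 𝔭.asIdeal →
      min (Module.lengthAt (IwasawaAlgebra p) Ds.X 𝔭) (Module.lengthAt (IwasawaAlgebra p) Df.X 𝔭) ≤
        Module.lengthAt (IwasawaAlgebra p) Y.X 𝔭 +
          Module.lengthAt (IwasawaAlgebra p) (Submodule.torsion (IwasawaAlgebra p) S.X) 𝔭)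
    (hMatar : matar2020_thm11_selmerDualTorsion_pseudoIso_fineSelmerDual)
    (hfine : Kato2004_fineSelmerDual_isTorsion) :
    ∀ (W : WeierstrassCurve ℚ) [W.IsElliptic] [W.IsGloballyMinimal] (p : ℕ) [Fact p.Prime]
      [ContinuousSMul ℤ_[p] (W.tateModule p)] [Module.Free ℤ_[p] (W.tateModule p)]
      [Module.Finite ℤ_[p] (W.tateModule p)],
      ClassX8 W p → ∀ (κ : ZpExtension ℚ p) (γ : Field.absoluteGaloisGroup ℚ),
      κ.IsCyclotomic → κ.IsTopGenerator γ → IsCyclotomicVariable p γ →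
    ∀ (v : HeightOneSpectrum (𝓞 ℚ)), (p : 𝓞 ℚ) ∈ v.asIdeal →
    ∀ (g : Field.absoluteGaloisGroup (v.adicCompletion ℚ)),
      κ.IsTopGenerator (resGalOfEmb (closureEmb (K := ℚ) (v.adicCompletion ℚ)) g) →
    ∀ (cneg : localPoints W (v.adicCompletion ℚ)) (c : ℕ → localPoints W (v.adicCompletion ℚ)),
      IsHondaSystem κ (closureEmb (K := ℚ) (v.adicCompletion ℚ)) W (W.frobeniusTrace p) g cneg c →
    ∀ (N : ℕ) (_ : NeZero N) (f : CuspForm (Gamma0 N) 2) (ϖ : ℚ) (Lsharp Lflat : IwasawaAlgebra p),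
      IsNewformOf W f → (ϖ : ℝ) * W.realPeriodRat = plusPeriod f →
      IsSprungPair f p (W.frobeniusTrace p) Lsharp Lflat →
    ∀ (I : Kato2004.IwasawaH1Data W p κ γ)
      (Cs : SharpFlatColemanKatoDataContra W p f ϖ κ γ (closureEmb (K := ℚ) (v.adicCompletion ℚ))
        (W.frobeniusTrace p) g c Chroma.sharp I)
      (Cf : SharpFlatColemanKatoDataContra W p f ϖ κ γ (closureEmb (K := ℚ) (v.adicCompletion ℚ))
        (W.frobeniusTrace p) g c Chroma.flat I),
      Cs.Z = Cf.Z →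
    ∀ (Y' : W.FineSelmerDualData κ γ⁻¹) (𝔭 : PrimeSpectrum (IwasawaAlgebra p)), 𝔭.asIdeal.height = 1 →
      (p : IwasawaAlgebra p) ∉ 𝔭.asIdeal → (PowerSeries.X : IwasawaAlgebra p) ∉ 𝔭.asIdeal →
      (∀ (col' : Chroma) (G' : IwasawaAlgebra p),
        iwasawaToPowerSeries p G' =
          PowerSeries.C (ϖ : ℚ_[p]) * iwasawaToPowerSeries p (chromaticL col' Lsharp Lflat) →
        G' ∈ 𝔭.asIdeal) →
      min (Module.lengthAt (IwasawaAlgebra p) (IwasawaAlgebra p ⧸ LinearMap.range Cs.colMap) 𝔭)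
          (Module.lengthAt (IwasawaAlgebra p) (IwasawaAlgebra p ⧸ LinearMap.range Cf.colMap) 𝔭) ≤
        Module.lengthAt (IwasawaAlgebra p) Y'.X (PrimeSpectrum.comap (invol p).toRingHom 𝔭) :=
  cokerBoundIotaOffT_contra_of_massIota
    (massIota_contra_of_cotorsion_of_fine (massCotorsion_contraFamily_of_family hM1)
      (cotorsion_contra_le_fine_comap_invol_of_matar hMatar hfine)) hfine

end ContraStub

end Summit.BirchSwinnertonDyer.BirchSwinnertonDyer.Theorems.ChromaticCommonZeros

end
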